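import Summits.Ventures.PercRepro.S1CoreCapSpecSpreadFiveLinesT

/-!
# PercRepro — TOWARDS THE INSTANCE `ν = 5` OF THE SPREAD SPEC: SIMPLE 3-POINT LINES, PART 2 — TRIANGLE-FREE, AND `≤ 7` (p1, gen 32)

`proofs/P1-S2-CORANK6.md` §4g. Configurations of simple 3-point lines of cost `≤ 5` under the spread clause WITHOUT a triangle (three lines
pairwise meeting have a common point). With two lines `A, X` through a point `a` and a third line `Y` not through `a` meeting `A`: `Y` misses
`X` (`tf_disjoint_of_meet`), the base `[Y, X, A]` has rank `4` and `7` points (`tf_base`), every other line meets it in at most one point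
(`tf_other_le_one`: inside the base it would close a triangle, with two points on it the spread clause refuses it), the lines meeting it in
exactly one point are at most two (`tf_W_le_two`: a third one is covered by the other two and the base, which forces the three to meet pairwise,
hence in a common point, hence to have only two points), the lines disjoint from it at most two (cost `3`): **`≤ 7` lines** (`tf_count`).
Otherwise every line through `a` is disjoint from every line avoiding `a` (`pencil_count`: at most five lines through `a`,
`not_six_through`; two of them leave `≤ 4` disjoint lines, three of them `≤ 2`), or all lines are pairwise disjoint (the lines other than one
satisfy the clause at nullity `4`: `card_le_six_of_three_points_spread`). **Every all-simple configuration has at most `7` lines**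
(`card_le_seven_of_three_points_spread_five`; the search's maximum is `6`). Axioms: standard.
-/

namespace PercRepro

namespace S1

namespace FourCap

variable {β : Type} [DecidableEq β]

section LinesTF

variable {w : β → ℕ} {ls : Finset (Finset β)}
  (hw1 : ∀ L ∈ ls, ∀ v ∈ L, w v = 1)
  (hcard : ∀ L ∈ ls, L.card = 3)
  (h3 : ∀ L ∈ ls, ∀ L' ∈ ls, L ≠ L' → (L ∩ L').card ≤ 1)
  (h4 : ∀ l : List (Finset β), l.Nodup → (∀ L ∈ l, L ∈ ls) → wsum w (unionL l) ≤ 5 + lineRank l)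
  (h7 : ∀ l : List (Finset β), l.Nodup → (∀ L ∈ l, L ∈ ls) → lineRank l ≤ 4 → wsum w (unionL l) ≤ lineRank l + 3)
  (htf : ∀ X ∈ ls, ∀ Y ∈ ls, ∀ Z ∈ ls, X ≠ Y → Y ≠ Z → X ≠ Z → (X ∩ Y).Nonempty → (Y ∩ Z).Nonempty →
    (X ∩ Z).Nonempty → (X ∩ Y ∩ Z).Nonempty)

include h3 htf in
/-- **Triangle-free: a line not through `a = A ∩ X` meeting `A` misses `X`.** -/
theorem tf_disjoint_of_meet {A X Y : Finset β} (hA : A ∈ ls) (hX : X ∈ ls) (hY : Y ∈ ls) (hAX : A ≠ X) (hYA : Y ≠ A)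
    (hYX : Y ≠ X) {a : β} (haA : a ∈ A) (haX : a ∈ X) (haY : a ∉ Y) (hmeet : (Y ∩ A).Nonempty) : Disjoint Y X := by
  by_contra hnd
  rw [Finset.not_disjoint_iff] at hnd
  obtain ⟨x, hxY, hxX⟩ := hnd
  obtain ⟨q, hq⟩ := htf A hA X hX Y hY hAX hYX.symm hYA.symm ⟨a, Finset.mem_inter.2 ⟨haA, haX⟩⟩
    ⟨x, Finset.mem_inter.2 ⟨hxX, hxY⟩⟩ (by obtain ⟨y, hy⟩ := hmeet; exact ⟨y, by rw [Finset.inter_comm]; exact hy⟩)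
  rw [Finset.mem_inter, Finset.mem_inter] at hq
  have : q = a := Finset.card_le_one.1 (h3 A hA X hX hAX) q (Finset.mem_inter.2 ⟨hq.1.1, hq.1.2⟩) a
    (Finset.mem_inter.2 ⟨haA, haX⟩)
  exact haY (this ▸ hq.2)

include hcard h3 in
/-- **The triangle-free base** `[Y, X, A]` (`a = A ∩ X`, `Y ∌ a` meeting `A` and missing `X`) has rank `4` and `7` points. -/
theorem tf_base {A X Y : Finset β} (hA : A ∈ ls) (hX : X ∈ ls) (hY : Y ∈ ls) (hAX : A ≠ X) (hYA : Y ≠ A)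
    {a : β} (haA : a ∈ A) (haX : a ∈ X) (hmeet : (Y ∩ A).Nonempty) (hYX : Disjoint Y X) :
    lineRank [Y, X, A] = 4 ∧ (unionL [Y, X, A]).card = 7 := by
  have kA := hcard A hA
  have kX := hcard X hX
  have kY := hcard Y hY
  have iXA : (X ∩ A).card = 1 := by
    have h := h3 X hX A hA hAX.symm
    have : 1 ≤ (X ∩ A).card := Finset.card_pos.2 ⟨a, Finset.mem_inter.2 ⟨haX, haA⟩⟩
    omega
  have iY : Y ∩ (X ∪ A) = Y ∩ A := by
    rw [Finset.inter_union_distrib_left, Finset.disjoint_iff_inter_eq_empty.1 hYX, Finset.empty_union]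
  have iYA : (Y ∩ A).card = 1 := by
    have h := h3 Y hY A hA hYA
    have : 1 ≤ (Y ∩ A).card := Finset.card_pos.2 hmeet
    omega
  have iYc : (Y ∩ (X ∪ A)).card = 1 := by rw [iY]; exact iYA
  have sX : (X \ A).card + (X ∩ A).card = X.card := Finset.card_sdiff_add_card_inter _ _
  have sY : (Y \ (X ∪ A)).card + (Y ∩ (X ∪ A)).card = Y.card := Finset.card_sdiff_add_card_inter _ _
  have uXA : (X ∪ A).card + (X ∩ A).card = X.card + A.card := Finset.card_union_add_card_inter _ _
  have uY : (Y ∪ (X ∪ A)).card + (Y ∩ (X ∪ A)).card = Y.card + (X ∪ A).card := Finset.card_union_add_card_inter _ _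
  simp only [unionL, lineRank, Finset.union_empty, Finset.sdiff_empty, Finset.inter_empty, Finset.card_empty,
    Nat.zero_add]
  rw [show (2 - min 0 2 : ℕ) = 2 by decide, iXA, iYc, show (2 - min 1 2 : ℕ) = 1 by decide]
  have : min A.card 2 = 2 := min_eq_right (by omega)
  constructor
  · omega
  · omega

include hw1 hcard h3 h7 htf in
/-- **Every other line meets the triangle-free base in at most one point**: inside it, it would meet `A`, `X`, `Y` once each and close a
triangle with `A, X` (through `a`) and with `A, Y` (through a point of `A` other than `a`); with two points on it and one off it the list
`[W, Y, X, A]` has rank `4` and `8` points. -/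
theorem tf_other_le_one {A X Y : Finset β} (hA : A ∈ ls) (hX : X ∈ ls) (hY : Y ∈ ls) (hAX : A ≠ X) (hYA : Y ≠ A)
    (hYX' : Y ≠ X) {a : β} (haA : a ∈ A) (haX : a ∈ X) (haY : a ∉ Y) (hmeet : (Y ∩ A).Nonempty) (hYX : Disjoint Y X)
    {W : Finset β} (hW : W ∈ ls) (hWA : W ≠ A) (hWX : W ≠ X) (hWY : W ≠ Y) : (W ∩ unionL [Y, X, A]).card ≤ 1 := by
  obtain ⟨hrank, hcardU⟩ := tf_base hcard h3 hA hX hY hAX hYA haA haX hmeet hYX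
  by_contra hlt
  push Not at hlt
  have hU : unionL [Y, X, A] = Y ∪ (X ∪ A) := by simp [unionL]
  have kW := hcard W hW
  by_cases hsub : W ⊆ unionL [Y, X, A]
  · -- inside the base: one point on each line, two triangles
    rw [hU] at hsub
    have hcov : W ⊆ (W ∩ Y) ∪ ((W ∩ X) ∪ (W ∩ A)) := by
      intro x hx
      have := hsub hx
      simp only [Finset.mem_union, Finset.mem_inter] at this ⊢
      tauto
    have hc1 := Finset.card_le_card hcov
    have hc2 := Finset.card_union_le (W ∩ Y) ((W ∩ X) ∪ (W ∩ A))
    have hc3 := Finset.card_union_le (W ∩ X) (W ∩ A)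
    have iA := h3 W hW A hA hWA
    have iX := h3 W hW X hX hWX
    have iY := h3 W hW Y hY hWY
    have nA : (W ∩ A).Nonempty := Finset.card_pos.1 (by omega)
    have nX : (W ∩ X).Nonempty := Finset.card_pos.1 (by omega)
    have nY : (W ∩ Y).Nonempty := Finset.card_pos.1 (by omega)
    -- the triangle `A, X, W` closes at `a`
    obtain ⟨q, hq⟩ := htf A hA X hX W hW hAX hWX.symm hWA.symm ⟨a, Finset.mem_inter.2 ⟨haA, haX⟩⟩
      (by obtain ⟨x, hx⟩ := nX; exact ⟨x, by rw [Finset.inter_comm]; exact hx⟩)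
      (by obtain ⟨x, hx⟩ := nA; exact ⟨x, by rw [Finset.inter_comm]; exact hx⟩)
    rw [Finset.mem_inter, Finset.mem_inter] at hq
    have hqa : q = a := Finset.card_le_one.1 (h3 A hA X hX hAX) q (Finset.mem_inter.2 ⟨hq.1.1, hq.1.2⟩) a
      (Finset.mem_inter.2 ⟨haA, haX⟩)
    have haW : a ∈ W := hqa ▸ hq.2
    -- the triangle `A, Y, W` closes at a point of `A ∩ W = {a}`, so `a ∈ Y`
    obtain ⟨q', hq'⟩ := htf A hA Y hY W hW hYA.symm hWY.symm hWA.symm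
      (by obtain ⟨x, hx⟩ := hmeet; exact ⟨x, by rw [Finset.inter_comm]; exact hx⟩)
      (by obtain ⟨x, hx⟩ := nY; exact ⟨x, by rw [Finset.inter_comm]; exact hx⟩)
      (by obtain ⟨x, hx⟩ := nA; exact ⟨x, by rw [Finset.inter_comm]; exact hx⟩)
    rw [Finset.mem_inter, Finset.mem_inter] at hq'
    have hq'a : q' = a := Finset.card_le_one.1 (h3 A hA W hW hWA.symm) q' (Finset.mem_inter.2 ⟨hq'.1.1, hq'.2⟩) a
      (Finset.mem_inter.2 ⟨haA, haW⟩)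
    exact haY (hq'a ▸ hq'.1.2)
  · -- two points on the base, one off it
    have hsd : (W \ unionL [Y, X, A]).card + (W ∩ unionL [Y, X, A]).card = W.card :=
      Finset.card_sdiff_add_card_inter _ _
    have hoff : 1 ≤ (W \ unionL [Y, X, A]).card := by
      rw [Nat.one_le_iff_ne_zero, Ne, Finset.card_eq_zero, Finset.sdiff_eq_empty_iff_subset]
      exact hsub
    have hb : ([Y, X, A] : List (Finset β)).Nodup := by simp [hAX.symm, hYA, hYX']
    have hbl : ∀ L ∈ ([Y, X, A] : List (Finset β)), L ∈ ls := by simp [hA, hX, hY]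
    have hwU : wsum w (unionL [Y, X, A]) = 7 := by
      rw [wsum_unionL_eq_card hw1 _ hbl, hcardU]
    exact not_meet_of_cost_three_rank hw1 hcard h7 hb hbl (by rw [hwU, hrank]) hW (by simp [hWA, hWX, hWY])
      (by omega) (by omega) (by omega)

include hw1 hcard h3 h4 in
/-- **The sixth line is covered**: over the base `[Y, X, A]` of rank `4` and `7` points, two lines `Z₁, Z₂` with one point each on the base
cost `1 + 1`, so a third line `Z₃` with one point on the base lies in `Z₂ ∪ Z₁ ∪ base`. -/
theorem tf_sixth_covered {A X Y : Finset β} (hA : A ∈ ls) (hX : X ∈ ls) (hY : Y ∈ ls) (hAX : A ≠ X) (hYA : Y ≠ A)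
    (hYX' : Y ≠ X) (hrank : lineRank [Y, X, A] = 4) (hcardU : (unionL [Y, X, A]).card = 7)
    {Z₁ Z₂ Z₃ : Finset β} (hZ₁ : Z₁ ∈ ls) (hZ₂ : Z₂ ∈ ls) (hZ₃ : Z₃ ∈ ls) (h1A : Z₁ ≠ A) (h1X : Z₁ ≠ X) (h1Y : Z₁ ≠ Y)
    (h2A : Z₂ ≠ A) (h2X : Z₂ ≠ X) (h2Y : Z₂ ≠ Y) (h3A : Z₃ ≠ A) (h3X : Z₃ ≠ X) (h3Y : Z₃ ≠ Y) (h21 : Z₂ ≠ Z₁)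
    (h31 : Z₃ ≠ Z₁) (h32 : Z₃ ≠ Z₂) (k1 : (Z₁ ∩ unionL [Y, X, A]).card = 1) (k2 : (Z₂ ∩ unionL [Y, X, A]).card = 1) :
    Z₃ ⊆ unionL [Z₂, Z₁, Y, X, A] := by
  have hw : ∀ L ∈ ls, ∀ v ∈ L, 1 ≤ w v := fun L hL v hv => by rw [hw1 L hL v hv]
  have hc := h4 [Z₃, Z₂, Z₁, Y, X, A] (by simp [hAX.symm, hYA, hYX', h1A, h1X, h1Y, h2A, h2X, h2Y, h3A, h3X, h3Y, h21, h31, h32])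
    (by simp [hA, hX, hY, hZ₁, hZ₂, hZ₃])
  obtain ⟨a1, b1, c1, d1⟩ := cost_step w Z₁ [Y, X, A] (hw Z₁ hZ₁)
  obtain ⟨a2, b2, c2, d2⟩ := cost_step w Z₂ [Z₁, Y, X, A] (hw Z₂ hZ₂)
  obtain ⟨a3, b3, c3, d3⟩ := cost_step w Z₃ [Z₂, Z₁, Y, X, A] (hw Z₃ hZ₃)
  have w1 := wsum_sdiff_eq_card hw1 hZ₁ (unionL [Y, X, A])
  have w2 := wsum_sdiff_eq_card hw1 hZ₂ (unionL [Z₁, Y, X, A])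
  have w3 := wsum_sdiff_eq_card hw1 hZ₃ (unionL [Z₂, Z₁, Y, X, A])
  have hwU : wsum w (unionL [Y, X, A]) = 7 := by
    rw [wsum_unionL_eq_card hw1 _ (by simp [hA, hX, hY]), hcardU]
  have e2 : unionL [Z₁, Y, X, A] = Z₁ ∪ unionL [Y, X, A] := rfl
  have i2 : (Z₂ ∩ unionL [Z₁, Y, X, A]).card ≤ 2 := by
    rw [e2, Finset.inter_union_distrib_left]
    refine (Finset.card_union_le _ _).trans ?_
    have := h3 Z₂ hZ₂ Z₁ hZ₁ h21
    omega
  have kZ₁ := hcard Z₁ hZ₁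
  have kZ₂ := hcard Z₂ hZ₂
  have kZ₃ := hcard Z₃ hZ₃
  have hzero : (Z₃ \ unionL [Z₂, Z₁, Y, X, A]).card = 0 := by
    rw [a3, a2, a1, hwU, w1, w2, w3] at hc
    rw [c3, c2, c1, hrank] at hc
    omega
  exact Finset.sdiff_eq_empty_iff_subset.1 (Finset.card_eq_zero.1 hzero)

include hw1 hcard h3 h4 htf in
/-- **At most two lines meet the triangle-free base in exactly one point**: three of them are pairwise covered by the other two and the
base (`tf_sixth_covered`), so they meet pairwise, hence (triangle-free) in a common point — and then the covered one has two points. -/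
theorem tf_W_le_two {A X Y : Finset β} (hA : A ∈ ls) (hX : X ∈ ls) (hY : Y ∈ ls) (hAX : A ≠ X) (hYA : Y ≠ A)
    (hYX' : Y ≠ X) (hrank : lineRank [Y, X, A] = 4) (hcardU : (unionL [Y, X, A]).card = 7) :
    (ls.filter (fun L => L ≠ A ∧ L ≠ X ∧ L ≠ Y ∧ (L ∩ unionL [Y, X, A]).card = 1)).card ≤ 2 := by
  by_contra hlt
  push Not at hlt
  obtain ⟨Z₁, Z₂, Z₃, hZ₁, hZ₂, hZ₃, h12, h13, h23⟩ := Finset.two_lt_card_iff.1 hlt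
  simp only [Finset.mem_filter] at hZ₁ hZ₂ hZ₃
  obtain ⟨hZ₁, h1A, h1X, h1Y, k1⟩ := hZ₁
  obtain ⟨hZ₂, h2A, h2X, h2Y, k2⟩ := hZ₂
  obtain ⟨hZ₃, h3A, h3X, h3Y, k3⟩ := hZ₃
  have e2 : ∀ Z Z' : Finset β, unionL [Z, Z', Y, X, A] = Z ∪ (Z' ∪ unionL [Y, X, A]) := fun _ _ => rfl
  -- a covered line meets the two covering lines
  have hmeet : ∀ {Z Z' Z'' : Finset β}, Z ∈ ls → Z' ∈ ls → Z'' ∈ ls → Z'' ≠ Z → Z'' ≠ Z' →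
      (Z'' ∩ unionL [Y, X, A]).card = 1 → Z'' ⊆ unionL [Z, Z', Y, X, A] → (Z'' ∩ Z).Nonempty ∧ (Z'' ∩ Z').Nonempty := by
    intro Z Z' Z'' hZ hZ' hZ'' hne hne' k hsub
    rw [e2] at hsub
    have hcov : Z'' ⊆ (Z'' ∩ Z) ∪ ((Z'' ∩ Z') ∪ (Z'' ∩ unionL [Y, X, A])) := by
      intro x hx
      have := hsub hx
      simp only [Finset.mem_union, Finset.mem_inter] at this ⊢
      tauto
    have hc1 := Finset.card_le_card hcov
    have hc2 := Finset.card_union_le (Z'' ∩ Z) ((Z'' ∩ Z') ∪ (Z'' ∩ unionL [Y, X, A]))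
    have hc3 := Finset.card_union_le (Z'' ∩ Z') (Z'' ∩ unionL [Y, X, A])
    have := h3 Z'' hZ'' Z hZ hne
    have := h3 Z'' hZ'' Z' hZ' hne'
    have := hcard Z'' hZ''
    exact ⟨Finset.card_pos.1 (by omega), Finset.card_pos.1 (by omega)⟩
  have c3 := tf_sixth_covered hw1 hcard h3 h4 hA hX hY hAX hYA hYX' hrank hcardU hZ₁ hZ₂ hZ₃ h1A h1X h1Y h2A h2X h2Y
    h3A h3X h3Y h12.symm h13.symm h23.symm k1 k2
  have c1 := tf_sixth_covered hw1 hcard h3 h4 hA hX hY hAX hYA hYX' hrank hcardU hZ₃ hZ₂ hZ₁ h3A h3X h3Y h2A h2X h2Y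
    h1A h1X h1Y h23 h13 h12 k3 k2
  obtain ⟨n32, n31⟩ := hmeet hZ₂ hZ₁ hZ₃ h23.symm h13.symm k3 c3
  obtain ⟨n12, _⟩ := hmeet hZ₂ hZ₃ hZ₁ h12 h13 k1 c1
  -- triangle-free: the three lines have a common point
  obtain ⟨q, hq⟩ := htf Z₁ hZ₁ Z₂ hZ₂ Z₃ hZ₃ h12 h23 h13 n12
    (by obtain ⟨x, hx⟩ := n32; exact ⟨x, by rw [Finset.inter_comm]; exact hx⟩)
    (by obtain ⟨x, hx⟩ := n31; exact ⟨x, by rw [Finset.inter_comm]; exact hx⟩)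
  rw [Finset.mem_inter, Finset.mem_inter] at hq
  -- then `Z₃ ∩ (Z₂ ∪ Z₁) = {q}`, but `Z₃` has two points off the base
  have i32 : Z₃ ∩ Z₂ = {q} := by
    refine Finset.eq_singleton_iff_unique_mem.2 ⟨Finset.mem_inter.2 ⟨hq.2, hq.1.2⟩, fun x hx => ?_⟩
    exact Finset.card_le_one.1 (h3 Z₃ hZ₃ Z₂ hZ₂ h23.symm) x hx q (Finset.mem_inter.2 ⟨hq.2, hq.1.2⟩)
  have i31 : Z₃ ∩ Z₁ = {q} := by
    refine Finset.eq_singleton_iff_unique_mem.2 ⟨Finset.mem_inter.2 ⟨hq.2, hq.1.1⟩, fun x hx => ?_⟩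
    exact Finset.card_le_one.1 (h3 Z₃ hZ₃ Z₁ hZ₁ h13.symm) x hx q (Finset.mem_inter.2 ⟨hq.2, hq.1.1⟩)
  rw [e2] at c3
  have hcov : Z₃ ⊆ {q} ∪ (Z₃ ∩ unionL [Y, X, A]) := by
    intro x hx
    have := c3 hx
    simp only [Finset.mem_union] at this
    rcases this with h | h | h
    · have : x ∈ Z₃ ∩ Z₂ := Finset.mem_inter.2 ⟨hx, h⟩
      rw [i32] at this
      exact Finset.mem_union_left _ this
    · have : x ∈ Z₃ ∩ Z₁ := Finset.mem_inter.2 ⟨hx, h⟩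
      rw [i31] at this
      exact Finset.mem_union_left _ this
    · exact Finset.mem_union_right _ (Finset.mem_inter.2 ⟨hx, h⟩)
  have hc := Finset.card_le_card hcov
  have hu := Finset.card_union_le ({q} : Finset β) (Z₃ ∩ unionL [Y, X, A])
  have := hcard Z₃ hZ₃
  rw [Finset.card_singleton] at hu
  omega

include hw1 hcard h3 h4 h7 htf in
/-- **Triangle-free with a line meeting a pencil pair off its centre: at most seven lines** — `A, X, Y`, at most two lines meeting the base
once, at most two disjoint from it. -/
theorem tf_count {A X Y : Finset β} (hA : A ∈ ls) (hX : X ∈ ls) (hY : Y ∈ ls) (hAX : A ≠ X) (hYA : Y ≠ A)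
    (hYX' : Y ≠ X) {a : β} (haA : a ∈ A) (haX : a ∈ X) (haY : a ∉ Y) (hmeet : (Y ∩ A).Nonempty) : ls.card ≤ 7 := by
  have hYX : Disjoint Y X := tf_disjoint_of_meet h3 htf hA hX hY hAX hYA hYX' haA haX haY hmeet
  obtain ⟨hrank, hcardU⟩ := tf_base hcard h3 hA hX hY hAX hYA haA haX hmeet hYX
  have hb : ([Y, X, A] : List (Finset β)).Nodup := by simp [hAX.symm, hYA, hYX']
  have hbl : ∀ L ∈ ([Y, X, A] : List (Finset β)), L ∈ ls := by simp [hA, hX, hY]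
  have hwU : wsum w (unionL [Y, X, A]) = 7 := by
    rw [wsum_unionL_eq_card hw1 _ hbl, hcardU]
  set 𝓦 := ls.filter (fun L => L ≠ A ∧ L ≠ X ∧ L ≠ Y ∧ (L ∩ unionL [Y, X, A]).card = 1) with h𝓦
  set 𝓓 := ls.filter (fun L => Disjoint L (unionL [Y, X, A])) with h𝓓
  have hD : 𝓓.card ≤ 2 :=
    card_filter_disjoint_le_two (h1_of_simple hw1) (h2_of_simple hw1 hcard) h3 h4 hb hbl (by rw [hrank, hwU])
  have hW : 𝓦.card ≤ 2 := tf_W_le_two hw1 hcard h3 h4 htf hA hX hY hAX hYA hYX' hrank hcardU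
  have hcover : ls ⊆ ({A, X, Y} : Finset (Finset β)) ∪ (𝓦 ∪ 𝓓) := by
    intro W hW
    rw [Finset.mem_union, Finset.mem_union, Finset.mem_insert, Finset.mem_insert, Finset.mem_singleton]
    by_cases hWA : W = A
    · exact Or.inl (Or.inl hWA)
    by_cases hWX : W = X
    · exact Or.inl (Or.inr (Or.inl hWX))
    by_cases hWY : W = Y
    · exact Or.inl (Or.inr (Or.inr hWY))
    have hle := tf_other_le_one hw1 hcard h3 h7 htf hA hX hY hAX hYA hYX' haA haX haY hmeet hYX hW hWA hWX hWY
    rcases (by omega : (W ∩ unionL [Y, X, A]).card = 1 ∨ (W ∩ unionL [Y, X, A]).card = 0) with h | h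
    · exact Or.inr (Or.inl (Finset.mem_filter.2 ⟨hW, hWA, hWX, hWY, h⟩))
    · refine Or.inr (Or.inr (Finset.mem_filter.2 ⟨hW, ?_⟩))
      rw [Finset.disjoint_iff_inter_eq_empty]
      exact Finset.card_eq_zero.1 h
  have hc := Finset.card_le_card hcover
  have hu1 := Finset.card_union_le ({A, X, Y} : Finset (Finset β)) (𝓦 ∪ 𝓓)
  have hu2 := Finset.card_union_le 𝓦 𝓓
  have h3' : ({A, X, Y} : Finset (Finset β)).card ≤ 3 := Finset.card_le_three
  omega

end LinesTF

end FourCap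

end S1

end PercRepro
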